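import Mathlib
import Summits.NavierStokesRegularity.NavierStokesRegularity.Theorems.AxisTwistDoorTiltDominationLocEnergyClass
import Summits.NavierStokesRegularity.NavierStokesRegularity.Theorems.AdaptedFrequencyFrequencyRigidityFiniteABAxisymmetric
import Summits.NavierStokesRegularity.NavierStokesRegularity.Theorems.PoloidalWindowDoorPoloidalWindowRigidityRotate
import Summits.NavierStokesRegularity.NavierStokesRegularity.Theorems.RellichScarSimilarityCovarianceRotationAB
import HarnessLib

/-!
# AxisTwistDoor · crux `TiltDominationLoc` (stmt-NavierStokesRegularity-26991, wall W3) — the counterexample is NOT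
# AXISYMMETRIC about any axis through the apex (portrait clause (xii); the «axisymmetric class slack» is CLOSED)

Helper file of the LEAD (ns-atd-p1 g5; `--supports stmt-NavierStokesRegularity-26991 --as helper`).  No definitions.
CORRECTION of CENSUS-26991-g4 §1/§3/§4 L-δ («for the BARE class of the crux the axisymmetric-with-swirl cell is NOT
in the tree and in print only as (AX-L)»): it IS in the tree.  Seregin–Šverák 2009, Thm. 3.1 (= Thm. 1.1: an
axisymmetric suitable weak solution with the Type-I rate `‖v‖ ≤ C/√(−t)` on a parabolic cylinder about a point of the
axis is regular there — a LOCAL statement, no boundedness or decay at spatial infinity, swirl allowed) is the tree's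
`…Theorems.rlAxisymRegular_of_repr` / `finiteAB_axisymmetricCore_unit` (route AdaptedFrequency, Albritton–Barker
class), and the energy-class inputs it consumes are AUTOMATIC for the crux's core class
(`…AxisTwistDoorTiltDominationLocEnergyClass.exists_energyClass_of_typeI`).  Hence:

* `not_isBackwardSingularPoint_of_isAxisymmetric` — a Type-I ancient Oseen-mild profile (rate, continuity on the open
  slab, Oseen identity, divergence-free slices) with AXISYMMETRIC slices about the vertical axis through the apex is NOT
  backward-singular at the apex — sign or no sign, swirl or no swirl;
* `not_isBackwardSingularPoint_of_isAxisymmetric_conj` — the same about ANY axis through the apex (conjugate by a linear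
  isometry: the class and the apex singularity are covariant);
* `not_isAxisymmetric_of_singular` — portrait clause (xii): the hypothetical W3 counterexample (one-signed, backward-
  singular Type-I profile) is axisymmetric about NO axis through its apex, in NO frame.

So Lei–Ren–Tian's Remark 1.3 («the half-space case seems nontrivial even for axisymmetric solutions») concerns only
solutions WITHOUT an a-priori Type-I bound; inside the Type-I door the axisymmetric cell carries no open content, and the
twisting term of CENSUS-26991-g5 §9 (which vanishes identically for axisymmetric fields) is the whole wall.
HONEST FRAMING: statements about HYPOTHETICAL Type-I blow-up profiles; W3 (26991), W4, W6, the leaf and Navier–Stokes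
regularity (Clay A) are OPEN; nothing here is an NS regularity statement.
[cite: SereginSverak2009, Thm. 3.1 (= Thm. 1.1)] [cite: KochNadirashviliSereginSverak2009, §1 (1.5) (axisymmetry)]
-/

noncomputable section

-- the summit and its single sub-problem share the name (CONVENTIONS §1), as in every Theorems file
set_option linter.dupNamespace false

namespace Summit.NavierStokesRegularity.NavierStokesRegularity.Theorems.AxisTwistDoorTiltDominationLocAxisymmetricExclusion

open Set Function MeasureTheory Filter Metric
open scoped InnerProductSpace
open Literature.Analysis Literature.Analysis.FluidPDE
open Summit.NavierStokesRegularity.NavierStokesRegularity.Theorems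
open Summit.NavierStokesRegularity.NavierStokesRegularity.Theorems.AxisTwistDoorTiltDominationLocEnergyClass
  (exists_energyClass_of_typeI)
open Summit.NavierStokesRegularity.NavierStokesRegularity.Theorems.PoloidalWindowDoorPoloidalWindowRigidityRotate
  (class_conj_linearIsometryEquiv)
open Summit.NavierStokesRegularity.NavierStokesRegularity.Theorems.RellichScarSimilarityCovariance
  (LIE.isBackwardSingularPoint_zero_conj)

variable {C : ℝ} {v : ℝ → EuclideanSpace ℝ (Fin 3) → EuclideanSpace ℝ (Fin 3)}

/-- **An axisymmetric Type-I ancient mild profile is not backward-singular at the apex** (Seregin–Šverák 2009 in the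
tree, fed with the automatic energy class).  Core class: Type-I rate, continuity on the open backward slab, the
unit-viscosity Oseen identity, divergence-free slices; hypothesis: every slice `v(t)`, `t < 0`, is axisymmetric about
the vertical axis (`IsAxisymmetric`, KNSS (1.5)).  No sign, no bound on the swirl, no decay at infinity is assumed.
[cite: SereginSverak2009, Thm. 3.1 (= Thm. 1.1)] -/
theorem not_isBackwardSingularPoint_of_isAxisymmetric (hrate : HasTypeITimeDecay C v)
    (hcont : ContinuousOn (uncurry v) (Iio (0 : ℝ) ×ˢ univ))
    (hmild : ∀ s t : ℝ, s < t → t < 0 → ∀ x,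
      v t x = UnboundedOperators.heatExtension (v s) (t - s) x - oseenDuhamel 1 s v v t x)
    (hdiv : ∀ t < 0, VectorCalculus.IsDivFree (v t))
    (hax : ∀ t < (0 : ℝ), IsAxisymmetric (v t)) :
    ¬ IsBackwardSingularPoint v 0 := by
  obtain ⟨π, H, hsw, hwg, hI⟩ := exists_energyClass_of_typeI hrate hcont hmild hdiv
  obtain ⟨q, hcl⟩ := ChiralWindowDoorClassDerivDecay.exists_classical_of_class hrate hcont hmild hdiv
  exact finiteAB_axisymmetricCore_unit C v π H hcl.smooth_velocity hsw hwg hrate (fun t ht => hax t ht) hI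

/-- **… about ANY axis through the apex**: if for some linear isometry `L` of `ℝ³` the conjugated profile
`t ↦ L ∘ v(t) ∘ L⁻¹` has axisymmetric slices (i.e. `v(t)` is axisymmetric about the axis `L⁻¹(ℝe₃)` through the
origin), the apex is not backward-singular: the core class (`class_conj_linearIsometryEquiv`) and the apex singularity
(`LIE.isBackwardSingularPoint_zero_conj`) are covariant under `L`. [cite: SereginSverak2009, Thm. 3.1 (= Thm. 1.1)] -/
theorem not_isBackwardSingularPoint_of_isAxisymmetric_conj (hrate : HasTypeITimeDecay C v)
    (hcont : ContinuousOn (uncurry v) (Iio (0 : ℝ) ×ˢ univ))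
    (hmild : ∀ s t : ℝ, s < t → t < 0 → ∀ x,
      v t x = UnboundedOperators.heatExtension (v s) (t - s) x - oseenDuhamel 1 s v v t x)
    (hdiv : ∀ t < 0, VectorCalculus.IsDivFree (v t))
    (L : EuclideanSpace ℝ (Fin 3) ≃ₗᵢ[ℝ] EuclideanSpace ℝ (Fin 3))
    (hax : ∀ t < (0 : ℝ), IsAxisymmetric (fun x => L (v t (L.symm x)))) :
    ¬ IsBackwardSingularPoint v 0 := by
  intro hsing
  obtain ⟨hrate', hcont', hmild', hdiv'⟩ := class_conj_linearIsometryEquiv L hrate hcont hmild hdiv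
  exact not_isBackwardSingularPoint_of_isAxisymmetric hrate' hcont' hmild' hdiv' hax
    (LIE.isBackwardSingularPoint_zero_conj L hsing)

/-- **Portrait clause (xii): the W3 counterexample is axisymmetric about no axis through its apex.**  A Type-I
ancient Oseen-mild profile which IS backward-singular at the apex — in particular the hypothetical one-signed
counterexample to crux 26991 (`…EnergyClass.oneSignedRigidity_iff_core`) — has, in every orthonormal frame `L`, some
slice that is not axisymmetric. [cite: SereginSverak2009, Thm. 3.1 (= Thm. 1.1)] -/
theorem not_isAxisymmetric_of_singular (hrate : HasTypeITimeDecay C v)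
    (hcont : ContinuousOn (uncurry v) (Iio (0 : ℝ) ×ˢ univ))
    (hmild : ∀ s t : ℝ, s < t → t < 0 → ∀ x,
      v t x = UnboundedOperators.heatExtension (v s) (t - s) x - oseenDuhamel 1 s v v t x)
    (hdiv : ∀ t < 0, VectorCalculus.IsDivFree (v t)) (hsing : IsBackwardSingularPoint v 0)
    (L : EuclideanSpace ℝ (Fin 3) ≃ₗᵢ[ℝ] EuclideanSpace ℝ (Fin 3)) :
    ∃ t < (0 : ℝ), ¬ IsAxisymmetric (fun x => L (v t (L.symm x))) := by
  by_contra h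
  push Not at h
  exact not_isBackwardSingularPoint_of_isAxisymmetric_conj hrate hcont hmild hdiv L h hsing

end Summit.NavierStokesRegularity.NavierStokesRegularity.Theorems.AxisTwistDoorTiltDominationLocAxisymmetricExclusion

end
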